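import Summits.ABC.IUTFork.LDHSlotRegimePointTransport
import Summits.ABC.IUTFork.LDHGenuineHullRegimeSzpiroSlackMixed
import Summits.ABC.IUTFork.Conditional.AbcOfSHvolSzpiroSuff
import HarnessLib

/-!
# The fork at [IUTchIII] Corollary 3.12, L-DH level, READING (U): the CONE binder `hvol` at `(λ, l)` FOLLOWS from a DATUM-FREE
# Szpiro-type bound on the MIXED split local height of `j(λ)` — the prove-direction of the Szpiro-type certificate, datum-free
# and in the same currency as the necessity (abc-iut cell, R2 S-chain team seat abc-iut-s2-p1; crux ThetaPartII = stmt-ABC-19678)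

Record-only PROOF file (D-0012) of the abc-iut cell; TAKES NO SIDE on [IUTchIII] Cor. 3.12 or on the (U)/(P) readings of
"−|log(Θ)|". Mochizuki, *Inter-universal Teichmüller theory IV* (RIMS manuscript Apr. 2020 = PRIMS **57** (2021)), Thm. 1.10 proof
Steps (ii)–(viii) pp. 24–30; Cor. 2.2 (ii) proof p. 46 ((P5)); Dupuy–Hilado [DupuyHilado2025] §3.3, §3.6, §4.7, §4.11–4.12.

Composition of abc-iut-s2-p1's `LDHGenuineHullRegimeSzpiroSlackMixed` (datum level: «((l+1)/24)·(weighted bad local height of `j_E`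
at the MIXED support primes) ≤ full slack of `B_III`» ⟹ `T.HullEstimateOf B_III`) with `LDHSlotRegimePointTransport` (the mixed
primes and the weighted bad local-height sums of the datum READ ON THE POINT `ℚ(j(λ)) ⊆ F_tpd`). Notation (spelled inline, nothing
defined): `F_mod := ℚ(j(λ)) = IntermediateField.adjoin ℚ {j(λ)}`; for a place `V` of `F_mod`, `V` is (P5)-bad iff `ord_V j(λ) < 0`,
`V ∤ 2`, `V ∤ l`; `h♭(V) := (−ord_V j(λ))·log N(V)/n_V` at bad `V`, `0` otherwise; a rational prime `p` is MIXED iff `h♭` is not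
constant on the places of `F_mod` above `p`; `H_mix(M) := Σ_{p∈M} Σ_{V|p bad} Pr(V)·h♭(V)` for a finite set `M` of primes.

* `PointDict.hullEstimateOf_BIII_of_pointMixedHeight_le_szpiroMax` / **`hullVolumeAtDatum_BIII_of_pointMixedHeight_le_szpiroMax`** —
  for `λ ∈ U_P` minimal, `l ≥ 7`, ANY finite set `M` of primes containing every mixed prime:
  `((l+1)/24)·H_mix(M) ≤ (l+1)/4·{(4(d_mod−1)/l)·(log-diff + log-cond) + (20/3)·log(d*·l)·max(0, π(d*·l) − (2d_mod(log-diff+log-cond)+log(30l))/log 2)}`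
  ⟹ `Cor22.HullVolumeAtDatum P l (B_III P l)`. NO datum, NO IUT object in the hypotheses.
* `Conditional.hvol_of_pointMixedSzpiro` / `hreg_of_pointMixedSzpiro` — the CONE binders `hvol` of `abc_of_S_v3` and `hreg` of
  `abc_of_S_v4` VERBATIM from that hypothesis at every admissible `(λ, l)` (`7 ≤ l` from (P6)); `ABC_of_cor312_of_pointMixedSzpiro` —
  on the (U) line, `ABC` from [IUTchIII] Cor. 3.12 at the genuine Θ-data + the datum-free mixed-height bound ALONE (c312-8's capstone).

READING (for the planners; nothing asserted about print). With abc-iut-s2-p2/abc-iut-s2-p5's NECESSITY («hvol(P,l) ⟹ ((l+1)/24)·(weighted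
bad local height at each mixed prime)·(1−O(ℓ⁻²ω⁻³)) ≤ B_III(P,l)», datum-free in `AbcOfSHvolSplitHeight` / `LDHSlotResidueMixedShare`)
the CONE binder of branch C is now SANDWICHED DATUM-FREE between two explicit inequalities on ONE arithmetic quantity of the point —
the `Pr`-weighted local height of `j(λ)`'s `q`-parameter at the primes of `ℚ(j(λ))` that split into places of different normalised
`q`-order: it HOLDS whenever that mixed height is below the Step-(iii)/(viii) slack of `B_III` (in particular at every `λ` with NO mixed
prime: `hullVolumeAtDatum_BIII_of_pointSlotConstant`), and it FORCES a Szpiro/abc-type bound on the same quantity. HONEST SCOPE: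
compositions BY NAME; no datum constructed; no side taken on Cor. 3.12 / Thm. 1.10 or on any author; the hypotheses are displayed, not
claimed; typed ≠ proved. PROOF-ONLY file: no definitions, no named `Prop` facts.
[cite: Mochizuki2012, IUTchIV Thm. 1.10 proof Steps (ii)–(viii) p. 24–30] [cite: Mochizuki2012, IUTchIV Cor. 2.2 (ii) proof p. 46]
[cite: DupuyHilado2025, §3.3, §3.6, §4.7, §4.11–4.12] [claim: Mochizuki2012, status: disputed] for every IUT quotation.
-/

noncomputable section

namespace Summit.ABC.IUTFork

open NumberField IsDedekindDomain Literature.IUT.LogVolume Literature.IUT.HodgeTheaters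
open Literature.NumberTheory.DiophantineGeometry.GenEll
open scoped Classical

namespace PointDict

variable {P : NFPoint} {l : ℕ}

/-- `log((2^12·3^3·5·d)·l) ≥ 0` for `d, l ≥ 1`. [cite: Mochizuki2012, IUTchIV Thm. 1.10 p. 22] -/
private theorem log_dstar_mul_nonneg₆ {d l : ℕ} (hd : 1 ≤ d) (hl : 1 ≤ l) :
    0 ≤ Real.log (((2 ^ 12 * 3 ^ 3 * 5 * d : ℕ) : ℝ) * l) := by
  apply Real.log_nonneg
  have h1 : (1 : ℝ) ≤ ((2 ^ 12 * 3 ^ 3 * 5 * d : ℕ) : ℝ) := by exact_mod_cast (by nlinarith : 1 ≤ 2 ^ 12 * 3 ^ 3 * 5 * d)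
  have h2 : (1 : ℝ) ≤ (l : ℝ) := by exact_mod_cast hl
  nlinarith

/-- The point-side summand is nonnegative: `Pr(V) ≥ 0` and `h♭(V) ≥ 0` (`−ord_V j(λ) > 0` at a bad place, `log N(V) > 0`).
[cite: DupuyHilado2025, §3.3, §3.6] -/
private theorem pointSummand_nonneg (V : HeightOneSpectrum (𝓞 ↥(IntermediateField.adjoin ℚ ({Cor22.jInv P.x} : Set P.F)))) :
    0 ≤ (if ord _ V (Cor22.jMod P) < 0 ∧ ((2 : ℕ) : 𝓞 _) ∉ V.asIdeal ∧ ((l : ℕ) : 𝓞 _) ∉ V.asIdeal then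
          weight _ V * (((-ord _ V (Cor22.jMod P) : ℤ) : ℝ) * logNorm _ V / (localDegree _ V : ℝ))
         else 0) := by
  split_ifs with h
  · refine mul_nonneg (weight_nonneg _ V) (div_nonneg (mul_nonneg ?_ (logNorm_pos _ V).le) (Nat.cast_nonneg _))
    have : (0 : ℤ) ≤ -ord _ V (Cor22.jMod P) := by omega
    exact_mod_cast this
  · exact le_rfl

/-- **READING (U), DATUM LEVEL with DATUM-FREE hypotheses: `T.HullEstimateOf (B_III P l)` from a bound on the mixed split local height
of `j(λ)`.** For `λ ∈ U_P` (minimally presented), `l ≥ 7`, a genuine Θ-volume datum `T` at `(P, l)` and ANY finite set `M` of primes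
containing every MIXED prime of the point: if `((l+1)/24)·H_mix(M) ≤ (l+1)/4·{(4(d_mod−1)/l)·(log-diff + log-cond) +
(20/3)·log(d*·l)·max(0, π(d*·l) − (2d_mod(log-diff+log-cond)+log(30l))/log 2)}` then `T.HullEstimateOf (B_III P l)`. Proof: the datum's
mixed support primes are mixed primes of the point (`not_pointConstant_of_not_slotConstant`), prime by prime the weighted bad local-height
sums agree (`sum_badHeight_weight_eq_point`), the remaining summands are `≥ 0`, and both count bounds turn the `max(0,·)` slack into the
datum's slack; then `hullEstimateOf_BIII_of_mixedLocalHeight_le_szpiroSlack'`.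
[cite: Mochizuki2012, IUTchIV Thm. 1.10 proof Steps (ii)–(viii) p. 24–30] [cite: DupuyHilado2025, §3.3, §3.6, §4.7]
[claim: Mochizuki2012, status: disputed] -/
theorem hullEstimateOf_BIII_of_pointMixedHeight_le_szpiroMax (T : Cor22.ThetaVolumeDatumAt P l) (hP : P ∈ UP) (h7 : 7 ≤ l)
    (M : Finset ℕ)
    (hM : ∀ p : ℕ, p.Prime →
      (¬ ∀ V W : HeightOneSpectrum (𝓞 ↥(IntermediateField.adjoin ℚ ({Cor22.jInv P.x} : Set P.F))),
        V ∈ placesOver _ p → W ∈ placesOver _ p →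
        (if ord _ V (Cor22.jMod P) < 0 ∧ ((2 : ℕ) : 𝓞 _) ∉ V.asIdeal ∧ ((l : ℕ) : 𝓞 _) ∉ V.asIdeal
          then ((-ord _ V (Cor22.jMod P) : ℤ) : ℝ) * logNorm _ V / (localDegree _ V : ℝ) else 0) =
        (if ord _ W (Cor22.jMod P) < 0 ∧ ((2 : ℕ) : 𝓞 _) ∉ W.asIdeal ∧ ((l : ℕ) : 𝓞 _) ∉ W.asIdeal
          then ((-ord _ W (Cor22.jMod P) : ℤ) : ℝ) * logNorm _ W / (localDegree _ W : ℝ) else 0)) → p ∈ M)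
    (h : ((l : ℝ) + 1) / 24 *
        ∑ p ∈ M, ∑ V : placesOver ↥(IntermediateField.adjoin ℚ ({Cor22.jInv P.x} : Set P.F)) p,
          (if ord _ V.1 (Cor22.jMod P) < 0 ∧ ((2 : ℕ) : 𝓞 _) ∉ V.1.asIdeal ∧ ((l : ℕ) : 𝓞 _) ∉ V.1.asIdeal then
            weight _ V.1 * (((-ord _ V.1 (Cor22.jMod P) : ℤ) : ℝ) * logNorm _ V.1 / (localDegree _ V.1 : ℝ))
           else 0) ≤
      ((l : ℝ) + 1) / 4 * (4 * ((Cor22.dmod P : ℝ) - 1) / l * (P.logDiff + Cor22.logCondAvoid P {2, l})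
        + 20 / 3 * Real.log (((2 ^ 12 * 3 ^ 3 * 5 * Cor22.dmod P : ℕ) : ℝ) * l)
          * max 0 (((Nat.primeCounting (2 ^ 12 * 3 ^ 3 * 5 * Cor22.dmod P * l) : ℝ)
            - (2 * (Cor22.dmod P : ℝ) * (P.logDiff + Cor22.logCondAvoid P {2, l}) + Real.log (2 * 3 * 5 * (l : ℝ)))
              / Real.log 2)))) :
    T.HullEstimateOf (((l : ℝ) + 1) / 4 * ((1 + 12 * (Cor22.dmod P : ℝ) / l) * (P.logDiff + Cor22.logCondAvoid P {2, l})
      + 2 * Real.log l + 52 + 20 / 3 * Real.log (((2 ^ 12 * 3 ^ 3 * 5 * Cor22.dmod P : ℕ) : ℝ) * (l : ℝ))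
        * (Nat.primeCounting (2 ^ 12 * 3 ^ 3 * 5 * Cor22.dmod P * l) : ℝ))) := by
  letI := T.instFieldF; letI := T.instNumberFieldF; letI := T.instAlgebraF; letI := T.instFieldK
  letI := T.instNumberFieldK; letI := T.instAlgebraK; letI := T.instFieldFbar; letI := T.instAlgebraFbar
  letI := T.instAlgebraKFbar; letI := T.instIsElliptic
  set Fm : Type := ↥(IntermediateField.adjoin ℚ ({Cor22.jInv P.x} : Set P.F)) with hFm
  set FE : Type := ↥(fieldOfModuli T.E) with hFE
  have hl1 : 1 ≤ l := by omega
  have hd : 1 ≤ Cor22.dmod P := Cor22.dmod_pos P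
  have hlmod := log_dstar_mul_nonneg₆ hd hl1
  have hl0 : (0 : ℝ) ≤ ((l : ℝ) + 1) / 24 := by positivity
  have hc0 : (0 : ℝ) ≤ ((l : ℝ) + 1) / 4 := by positivity
  refine hullEstimateOf_BIII_of_mixedLocalHeight_le_szpiroSlack' T hP h7 (le_trans ?_ (h.trans ?_))
  · -- the datum's mixed sum ≤ the point's `M`-sum
    apply mul_le_mul_of_nonneg_left _ hl0
    set MF := T.I.supportPrimes.filter (fun p => ¬ ∀ v w : placesOver FE p,
        (DHData.ofInput T.I).logQloc p v = (DHData.ofInput T.I).logQloc p w) with hMF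
    -- prime by prime the sums agree (weight descent to `F` twice)
    have heq : ∑ p ∈ MF, ∑ v : placesOver FE p,
        (if v.1 ∈ ThetaData.badPrimesMod T.D then
          weight FE v.1 * (((-ord FE v.1 (ThetaData.jMod T.E) : ℤ) : ℝ) * logNorm FE v.1 / (localDegree FE v.1 : ℝ))
         else 0) =
        ∑ p ∈ MF, ∑ V : placesOver Fm p,
          (if ord Fm V.1 (Cor22.jMod P) < 0 ∧ ((2 : ℕ) : 𝓞 Fm) ∉ V.1.asIdeal ∧ ((l : ℕ) : 𝓞 Fm) ∉ V.1.asIdeal then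
            weight Fm V.1 * (((-ord Fm V.1 (Cor22.jMod P) : ℤ) : ℝ) * logNorm Fm V.1 / (localDegree Fm V.1 : ℝ))
           else 0) := by
      refine Finset.sum_congr rfl fun p hp => ?_
      haveI : Fact p.Prime := ⟨T.I.prime_of_mem_supportPrimes (Finset.mem_filter.1 hp).1⟩
      exact sum_badHeight_weight_eq_point T p
    rw [heq]
    -- the datum's mixed primes are mixed primes of the point, hence in `M`; the other summands are `≥ 0`
    refine Finset.sum_le_sum_of_subset_of_nonneg (fun p hp => ?_) (fun p _ _ => ?_)
    · obtain ⟨hpT, hnot⟩ := Finset.mem_filter.1 hp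
      haveI : Fact p.Prime := ⟨T.I.prime_of_mem_supportPrimes hpT⟩
      exact hM p (T.I.prime_of_mem_supportPrimes hpT) (not_pointConstant_of_not_slotConstant T p hnot)
    · exact Finset.sum_nonneg fun V _ => pointSummand_nonneg V.1
  · -- `max(0, π − B) ≤ π − #{p ∈ T(I) ≤ d*l}`
    have hcntB := card_supportPrimes_filter_le T hP (2 ^ 12 * 3 ^ 3 * 5 * Cor22.dmod P * l)
    have hcntπ : (((T.I.supportPrimes.filter (· ≤ 2 ^ 12 * 3 ^ 3 * 5 * Cor22.dmod P * l)).card : ℝ)) ≤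
        (Nat.primeCounting (2 ^ 12 * 3 ^ 3 * 5 * Cor22.dmod P * l) : ℝ) := by
      have hsub : T.I.supportPrimes.filter (· ≤ 2 ^ 12 * 3 ^ 3 * 5 * Cor22.dmod P * l) ⊆
          Nat.primesLE (2 ^ 12 * 3 ^ 3 * 5 * Cor22.dmod P * l) := by
        intro p hp
        rw [Finset.mem_filter] at hp
        rw [Nat.mem_primesLE]
        exact ⟨hp.2, T.I.prime_of_mem_supportPrimes hp.1⟩
      have hc : (T.I.supportPrimes.filter (· ≤ 2 ^ 12 * 3 ^ 3 * 5 * Cor22.dmod P * l)).card ≤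
          Nat.primeCounting (2 ^ 12 * 3 ^ 3 * 5 * Cor22.dmod P * l) := by
        rw [← Nat.primesLE_card_eq_primeCounting]; exact Finset.card_le_card hsub
      exact_mod_cast hc
    have hmax : max 0 (((Nat.primeCounting (2 ^ 12 * 3 ^ 3 * 5 * Cor22.dmod P * l) : ℝ)
            - (2 * (Cor22.dmod P : ℝ) * (P.logDiff + Cor22.logCondAvoid P {2, l}) + Real.log (2 * 3 * 5 * (l : ℝ)))
              / Real.log 2)) ≤
        ((Nat.primeCounting (2 ^ 12 * 3 ^ 3 * 5 * Cor22.dmod P * l) : ℝ)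
          - ((T.I.supportPrimes.filter (· ≤ 2 ^ 12 * 3 ^ 3 * 5 * Cor22.dmod P * l)).card : ℝ)) :=
      max_le (by linarith) (by linarith)
    apply mul_le_mul_of_nonneg_left _ hc0
    have h2 := mul_le_mul_of_nonneg_left hmax hlmod
    have h20 := mul_le_mul_of_nonneg_left h2 (show (0 : ℝ) ≤ 20 / 3 by norm_num)
    have e1 : 20 / 3 * (Real.log (((2 ^ 12 * 3 ^ 3 * 5 * Cor22.dmod P : ℕ) : ℝ) * l) *
        max 0 (((Nat.primeCounting (2 ^ 12 * 3 ^ 3 * 5 * Cor22.dmod P * l) : ℝ)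
          - (2 * (Cor22.dmod P : ℝ) * (P.logDiff + Cor22.logCondAvoid P {2, l}) + Real.log (2 * 3 * 5 * (l : ℝ)))
            / Real.log 2))) =
        20 / 3 * Real.log (((2 ^ 12 * 3 ^ 3 * 5 * Cor22.dmod P : ℕ) : ℝ) * l) *
          max 0 (((Nat.primeCounting (2 ^ 12 * 3 ^ 3 * 5 * Cor22.dmod P * l) : ℝ)
            - (2 * (Cor22.dmod P : ℝ) * (P.logDiff + Cor22.logCondAvoid P {2, l}) + Real.log (2 * 3 * 5 * (l : ℝ)))
              / Real.log 2)) := by ring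
    have e2 : 20 / 3 * (Real.log (((2 ^ 12 * 3 ^ 3 * 5 * Cor22.dmod P : ℕ) : ℝ) * l)
        * ((Nat.primeCounting (2 ^ 12 * 3 ^ 3 * 5 * Cor22.dmod P * l) : ℝ)
          - ((T.I.supportPrimes.filter (· ≤ 2 ^ 12 * 3 ^ 3 * 5 * Cor22.dmod P * l)).card : ℝ))) =
        20 / 3 * Real.log (((2 ^ 12 * 3 ^ 3 * 5 * Cor22.dmod P : ℕ) : ℝ) * l)
          * ((Nat.primeCounting (2 ^ 12 * 3 ^ 3 * 5 * Cor22.dmod P * l) : ℝ)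
            - ((T.I.supportPrimes.filter (· ≤ 2 ^ 12 * 3 ^ 3 * 5 * Cor22.dmod P * l)).card : ℝ)) := by ring
    linarith

/-- **The `∀ T` form, FULLY DATUM-FREE HYPOTHESES: `Cor22.HullVolumeAtDatum P l (B_III P l)`** — the CONE binder `hvol` of
`abc_of_S_v3` at `(P, l)` — for `λ ∈ U_P` (minimally presented), `l ≥ 7`, whenever for some finite set `M` of primes containing every
mixed prime of `λ` (w.r.t. `ℚ(j(λ))`, `2`, `l`): `((l+1)/24)·H_mix(M) ≤ (l+1)/4·{(4(d_mod−1)/l)·(log-diff + log-cond) +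
(20/3)·log(d*·l)·max(0, π(d*·l) − (2d_mod(log-diff+log-cond)+log(30l))/log 2)}` — a Szpiro-type inequality on the MIXED split local
height of `j(λ)` with conductor coefficient `24(d_mod−1)/l`. [cite: Mochizuki2012, IUTchIV Thm. 1.10 proof Steps (ii)–(viii) p. 24–30]
[cite: DupuyHilado2025, §3.3, §3.6, §4.7] [claim: Mochizuki2012, status: disputed] -/
theorem hullVolumeAtDatum_BIII_of_pointMixedHeight_le_szpiroMax (hP : P ∈ UP) (h7 : 7 ≤ l) (M : Finset ℕ)
    (hM : ∀ p : ℕ, p.Prime →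
      (¬ ∀ V W : HeightOneSpectrum (𝓞 ↥(IntermediateField.adjoin ℚ ({Cor22.jInv P.x} : Set P.F))),
        V ∈ placesOver _ p → W ∈ placesOver _ p →
        (if ord _ V (Cor22.jMod P) < 0 ∧ ((2 : ℕ) : 𝓞 _) ∉ V.asIdeal ∧ ((l : ℕ) : 𝓞 _) ∉ V.asIdeal
          then ((-ord _ V (Cor22.jMod P) : ℤ) : ℝ) * logNorm _ V / (localDegree _ V : ℝ) else 0) =
        (if ord _ W (Cor22.jMod P) < 0 ∧ ((2 : ℕ) : 𝓞 _) ∉ W.asIdeal ∧ ((l : ℕ) : 𝓞 _) ∉ W.asIdeal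
          then ((-ord _ W (Cor22.jMod P) : ℤ) : ℝ) * logNorm _ W / (localDegree _ W : ℝ) else 0)) → p ∈ M)
    (h : ((l : ℝ) + 1) / 24 *
        ∑ p ∈ M, ∑ V : placesOver ↥(IntermediateField.adjoin ℚ ({Cor22.jInv P.x} : Set P.F)) p,
          (if ord _ V.1 (Cor22.jMod P) < 0 ∧ ((2 : ℕ) : 𝓞 _) ∉ V.1.asIdeal ∧ ((l : ℕ) : 𝓞 _) ∉ V.1.asIdeal then
            weight _ V.1 * (((-ord _ V.1 (Cor22.jMod P) : ℤ) : ℝ) * logNorm _ V.1 / (localDegree _ V.1 : ℝ))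
           else 0) ≤
      ((l : ℝ) + 1) / 4 * (4 * ((Cor22.dmod P : ℝ) - 1) / l * (P.logDiff + Cor22.logCondAvoid P {2, l})
        + 20 / 3 * Real.log (((2 ^ 12 * 3 ^ 3 * 5 * Cor22.dmod P : ℕ) : ℝ) * l)
          * max 0 (((Nat.primeCounting (2 ^ 12 * 3 ^ 3 * 5 * Cor22.dmod P * l) : ℝ)
            - (2 * (Cor22.dmod P : ℝ) * (P.logDiff + Cor22.logCondAvoid P {2, l}) + Real.log (2 * 3 * 5 * (l : ℝ)))
              / Real.log 2)))) :
    Cor22.HullVolumeAtDatum P l (((l : ℝ) + 1) / 4 * ((1 + 12 * (Cor22.dmod P : ℝ) / l)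
      * (P.logDiff + Cor22.logCondAvoid P {2, l}) + 2 * Real.log l + 52
        + 20 / 3 * Real.log (((2 ^ 12 * 3 ^ 3 * 5 * Cor22.dmod P : ℕ) : ℝ) * (l : ℝ))
          * (Nat.primeCounting (2 ^ 12 * 3 ^ 3 * 5 * Cor22.dmod P * l) : ℝ))) :=
  fun T => hullEstimateOf_BIII_of_pointMixedHeight_le_szpiroMax T hP h7 M hM h

end PointDict

namespace Conditional

/-- **The CONE binder `hvol` of `abc_of_S_v3` FOLLOWS from the datum-free mixed-height Szpiro-type bound at every admissible `(λ, l)`**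
(`λ ∈ U_X` minimal, `l` prime `≥ 5`, «admits an `F`-core», (P2), (P5), (P6); `7 ≤ l` from (P6) by abc-iut-c312-8's
`ThetaPartII.seven_le_of_condP6`). Usage: `abc_of_S_v3 H (hvol_of_pointMixedSzpiro hMix)`. Nothing asserted about the antecedent.
[cite: Mochizuki2012, IUTchIV Thm. 1.10 proof Steps (ii)–(viii) p. 24–30] [claim: Mochizuki2012, status: disputed] -/
theorem hvol_of_pointMixedSzpiro
    (hMix : ∀ P : NFPoint, P ∈ UP → ∀ l : ℕ, l.Prime → 5 ≤ l →
      Cor22.AdmitsCore P → Cor22.CondP2 P l → Cor22.CondP5 P l → Cor22.CondP6 P l →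
      ∃ M : Finset ℕ,
        (∀ p : ℕ, p.Prime →
          (¬ ∀ V W : HeightOneSpectrum (𝓞 ↥(IntermediateField.adjoin ℚ ({Cor22.jInv P.x} : Set P.F))),
            V ∈ placesOver _ p → W ∈ placesOver _ p →
            (if ord _ V (Cor22.jMod P) < 0 ∧ ((2 : ℕ) : 𝓞 _) ∉ V.asIdeal ∧ ((l : ℕ) : 𝓞 _) ∉ V.asIdeal
              then ((-ord _ V (Cor22.jMod P) : ℤ) : ℝ) * logNorm _ V / (localDegree _ V : ℝ) else 0) =
            (if ord _ W (Cor22.jMod P) < 0 ∧ ((2 : ℕ) : 𝓞 _) ∉ W.asIdeal ∧ ((l : ℕ) : 𝓞 _) ∉ W.asIdeal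
              then ((-ord _ W (Cor22.jMod P) : ℤ) : ℝ) * logNorm _ W / (localDegree _ W : ℝ) else 0)) → p ∈ M) ∧
        ((l : ℝ) + 1) / 24 *
            ∑ p ∈ M, ∑ V : placesOver ↥(IntermediateField.adjoin ℚ ({Cor22.jInv P.x} : Set P.F)) p,
              (if ord _ V.1 (Cor22.jMod P) < 0 ∧ ((2 : ℕ) : 𝓞 _) ∉ V.1.asIdeal ∧ ((l : ℕ) : 𝓞 _) ∉ V.1.asIdeal then
                weight _ V.1 * (((-ord _ V.1 (Cor22.jMod P) : ℤ) : ℝ) * logNorm _ V.1 / (localDegree _ V.1 : ℝ))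
               else 0) ≤
          ((l : ℝ) + 1) / 4 * (4 * ((Cor22.dmod P : ℝ) - 1) / l * (P.logDiff + Cor22.logCondAvoid P {2, l})
            + 20 / 3 * Real.log (((2 ^ 12 * 3 ^ 3 * 5 * Cor22.dmod P : ℕ) : ℝ) * l)
              * max 0 (((Nat.primeCounting (2 ^ 12 * 3 ^ 3 * 5 * Cor22.dmod P * l) : ℝ)
                - (2 * (Cor22.dmod P : ℝ) * (P.logDiff + Cor22.logCondAvoid P {2, l}) + Real.log (2 * 3 * 5 * (l : ℝ)))
                  / Real.log 2)))) :
    ∀ P₀ : NFPoint, P₀ ∈ UP → ∀ l : ℕ, l.Prime → 5 ≤ l →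
      Cor22.AdmitsCore P₀ → Cor22.CondP2 P₀ l → Cor22.CondP5 P₀ l → Cor22.CondP6 P₀ l →
        Cor22.HullVolumeAtDatum P₀ l (((l : ℝ) + 1) / 4 *
          ((1 + 12 * (Cor22.dmod P₀ : ℝ) / l) * (P₀.logDiff + Cor22.logCondAvoid P₀ {2, l})
            + 2 * Real.log l + 52
            + 20 / 3 * Real.log (((2 ^ 12 * 3 ^ 3 * 5 * Cor22.dmod P₀ : ℕ) : ℝ) * (l : ℝ))
              * (Nat.primeCounting (2 ^ 12 * 3 ^ 3 * 5 * Cor22.dmod P₀ * l) : ℝ))) := by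
  intro P hP l hl h5 hc h2 h5' h6
  have h7 : 7 ≤ l := Summit.ABC.ABC.Theorems.ThetaPartII.seven_le_of_condP6 hP hl h5 h6
  obtain ⟨M, hM, h⟩ := hMix P hP l hl h5 hc h2 h5' h6
  exact PointDict.hullVolumeAtDatum_BIII_of_pointMixedHeight_le_szpiroMax hP h7 M hM h

/-- **The CONE binder `hreg` of `abc_of_S_v4` from the same datum-free hypothesis** (the regime clause is not used).
Usage: `abc_of_S_v4 H (hreg_of_pointMixedSzpiro hMix)`. Nothing asserted about the antecedent.
[cite: Mochizuki2012, IUTchIV Thm. 1.10 proof Steps (ii)–(viii) p. 24–30] [claim: Mochizuki2012, status: disputed] -/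
theorem hreg_of_pointMixedSzpiro
    (hMix : ∀ P : NFPoint, P ∈ UP → ∀ l : ℕ, l.Prime → 5 ≤ l →
      Cor22.AdmitsCore P → Cor22.CondP2 P l → Cor22.CondP5 P l → Cor22.CondP6 P l →
      ∃ M : Finset ℕ,
        (∀ p : ℕ, p.Prime →
          (¬ ∀ V W : HeightOneSpectrum (𝓞 ↥(IntermediateField.adjoin ℚ ({Cor22.jInv P.x} : Set P.F))),
            V ∈ placesOver _ p → W ∈ placesOver _ p →
            (if ord _ V (Cor22.jMod P) < 0 ∧ ((2 : ℕ) : 𝓞 _) ∉ V.asIdeal ∧ ((l : ℕ) : 𝓞 _) ∉ V.asIdeal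
              then ((-ord _ V (Cor22.jMod P) : ℤ) : ℝ) * logNorm _ V / (localDegree _ V : ℝ) else 0) =
            (if ord _ W (Cor22.jMod P) < 0 ∧ ((2 : ℕ) : 𝓞 _) ∉ W.asIdeal ∧ ((l : ℕ) : 𝓞 _) ∉ W.asIdeal
              then ((-ord _ W (Cor22.jMod P) : ℤ) : ℝ) * logNorm _ W / (localDegree _ W : ℝ) else 0)) → p ∈ M) ∧
        ((l : ℝ) + 1) / 24 *
            ∑ p ∈ M, ∑ V : placesOver ↥(IntermediateField.adjoin ℚ ({Cor22.jInv P.x} : Set P.F)) p,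
              (if ord _ V.1 (Cor22.jMod P) < 0 ∧ ((2 : ℕ) : 𝓞 _) ∉ V.1.asIdeal ∧ ((l : ℕ) : 𝓞 _) ∉ V.1.asIdeal then
                weight _ V.1 * (((-ord _ V.1 (Cor22.jMod P) : ℤ) : ℝ) * logNorm _ V.1 / (localDegree _ V.1 : ℝ))
               else 0) ≤
          ((l : ℝ) + 1) / 4 * (4 * ((Cor22.dmod P : ℝ) - 1) / l * (P.logDiff + Cor22.logCondAvoid P {2, l})
            + 20 / 3 * Real.log (((2 ^ 12 * 3 ^ 3 * 5 * Cor22.dmod P : ℕ) : ℝ) * l)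
              * max 0 (((Nat.primeCounting (2 ^ 12 * 3 ^ 3 * 5 * Cor22.dmod P * l) : ℝ)
                - (2 * (Cor22.dmod P : ℝ) * (P.logDiff + Cor22.logCondAvoid P {2, l}) + Real.log (2 * 3 * 5 * (l : ℝ)))
                  / Real.log 2)))) :
    ∀ P : NFPoint, P ∈ UP → ∀ l : ℕ, l.Prime → 5 ≤ l →
      Cor22.AdmitsCore P → Cor22.CondP2 P l → Cor22.CondP5 P l → Cor22.CondP6 P l →
      ∀ T : Cor22.ThetaVolumeDatumAt P l,
        (letI := T.instFieldF; letI := T.instNumberFieldF; letI := T.instAlgebraF; letI := T.instFieldK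
         letI := T.instNumberFieldK; letI := T.instAlgebraK; letI := T.instFieldFbar; letI := T.instAlgebraFbar
         letI := T.instAlgebraKFbar; letI := T.instIsElliptic
         ¬ (∀ p ∈ T.I.supportPrimes, ∀ v w : placesOver (fieldOfModuli T.E) p,
            (Summit.ABC.IUTFork.DHData.ofInput T.I).logQloc p v = (Summit.ABC.IUTFork.DHData.ofInput T.I).logQloc p w)) →
        T.HullEstimateOf
          (((l : ℝ) + 1) / 4 *
            ((1 + 12 * (Cor22.dmod P : ℝ) / l) * (P.logDiff + Cor22.logCondAvoid P {2, l})
              + 2 * Real.log l + 52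
              + 20 / 3 * Real.log (((2 ^ 12 * 3 ^ 3 * 5 * Cor22.dmod P : ℕ) : ℝ) * (l : ℝ))
                * (Nat.primeCounting (2 ^ 12 * 3 ^ 3 * 5 * Cor22.dmod P * l) : ℝ))) :=
  fun P hP l hl h5 hc h2 h5' h6 T _ => hvol_of_pointMixedSzpiro hMix P hP l hl h5 hc h2 h5' h6 T

/-- **ON THE (U) LINE: `ABC` from [IUTchIII] Cor. 3.12 at the genuine Θ-volume data of the admissible Legendre points AND the datum-free
mixed-height Szpiro-type bound ALONE** (abc-iut-c312-8's capstone `ThetaPartII.ABC_of_cor312_of_hullRegime`; [GenEll] Thm 2.1 at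
`Σ = {2}`, the Θ-data (P7), the tower arithmetic, Thm. 1.10's numerics and Cor. 2.2's reduction PROVED inside). CONDITIONAL; nothing
asserted about either hypothesis; no side taken. [cite: Mochizuki2012, IUTchIV Cor. 2.2 (ii) proof p. 45–46] [claim: Mochizuki2012, status: disputed] -/
theorem ABC_of_cor312_of_pointMixedSzpiro
    (h312 : ∀ P : NFPoint, P ∈ UP → ∀ l : ℕ, l.Prime → 5 ≤ l →
      Cor22.AdmitsCore P → Cor22.CondP2 P l → Cor22.CondP5 P l → Cor22.CondP6 P l →
        Cor22.Cor312AtDatum P l)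
    (hMix : ∀ P : NFPoint, P ∈ UP → ∀ l : ℕ, l.Prime → 5 ≤ l →
      Cor22.AdmitsCore P → Cor22.CondP2 P l → Cor22.CondP5 P l → Cor22.CondP6 P l →
      ∃ M : Finset ℕ,
        (∀ p : ℕ, p.Prime →
          (¬ ∀ V W : HeightOneSpectrum (𝓞 ↥(IntermediateField.adjoin ℚ ({Cor22.jInv P.x} : Set P.F))),
            V ∈ placesOver _ p → W ∈ placesOver _ p →
            (if ord _ V (Cor22.jMod P) < 0 ∧ ((2 : ℕ) : 𝓞 _) ∉ V.asIdeal ∧ ((l : ℕ) : 𝓞 _) ∉ V.asIdeal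
              then ((-ord _ V (Cor22.jMod P) : ℤ) : ℝ) * logNorm _ V / (localDegree _ V : ℝ) else 0) =
            (if ord _ W (Cor22.jMod P) < 0 ∧ ((2 : ℕ) : 𝓞 _) ∉ W.asIdeal ∧ ((l : ℕ) : 𝓞 _) ∉ W.asIdeal
              then ((-ord _ W (Cor22.jMod P) : ℤ) : ℝ) * logNorm _ W / (localDegree _ W : ℝ) else 0)) → p ∈ M) ∧
        ((l : ℝ) + 1) / 24 *
            ∑ p ∈ M, ∑ V : placesOver ↥(IntermediateField.adjoin ℚ ({Cor22.jInv P.x} : Set P.F)) p,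
              (if ord _ V.1 (Cor22.jMod P) < 0 ∧ ((2 : ℕ) : 𝓞 _) ∉ V.1.asIdeal ∧ ((l : ℕ) : 𝓞 _) ∉ V.1.asIdeal then
                weight _ V.1 * (((-ord _ V.1 (Cor22.jMod P) : ℤ) : ℝ) * logNorm _ V.1 / (localDegree _ V.1 : ℝ))
               else 0) ≤
          ((l : ℝ) + 1) / 4 * (4 * ((Cor22.dmod P : ℝ) - 1) / l * (P.logDiff + Cor22.logCondAvoid P {2, l})
            + 20 / 3 * Real.log (((2 ^ 12 * 3 ^ 3 * 5 * Cor22.dmod P : ℕ) : ℝ) * l)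
              * max 0 (((Nat.primeCounting (2 ^ 12 * 3 ^ 3 * 5 * Cor22.dmod P * l) : ℝ)
                - (2 * (Cor22.dmod P : ℝ) * (P.logDiff + Cor22.logCondAvoid P {2, l}) + Real.log (2 * 3 * 5 * (l : ℝ)))
                  / Real.log 2)))) :
    _root_.ABC :=
  Summit.ABC.ABC.Theorems.ThetaPartII.ABC_of_cor312_of_hullRegime h312 (hreg_of_pointMixedSzpiro hMix)

end Conditional

end Summit.ABC.IUTFork

end
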